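import Mathlib
import Literature.Probability.Percolation.DiagonalStripCharacterWheel
import Literature.Probability.Percolation.DiagonalStripExactGroundState
import Literature.Probability.Percolation.DiagonalStripPairingRecursion
import Literature.Probability.Percolation.DiagonalStripScalarPinning
import Literature.Probability.Percolation.DiagonalStripSumRecursion
import HarnessLib

/-!
# IP12 Proposition 3.4: the ground-state sum is the symplectic character (conditional form)

Topic `Literature/Probability/Percolation`. Ikhlef–Ponsaing (J. Stat. Phys. 149 (2012),
arXiv:1202.5476) Prop. 3.4: `Z_L = Σ_α ψ_α = χ_L(z_1², …, z_L²)`. For the primitive polynomial ground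
state `P` of the cluster transfer matrix `t(w; z⃗)` (`DiagonalStripExactGroundState`) this file proves

  **`sum_eq_C_mul_uSq_uChar`**: if the `(z_1, z_2)` pair degree of `Z = Σ_Q P_Q` is `≤ 8m - 2` and
  `Z` is free of `w`, then `Z = κ · χ̂_L(z_1², …, z_L²)` with `κ ∈ ℂˣ` (`χ̂_L = uChar`, the polynomial
  numerator of IP12's character, `DiagonalStripCharacterWheel`) and the reflection twist is
  `a' = -2m`.

The two hypotheses are the only input not derived here from the transfer matrix; they hold for the
minimal-degree solution of the qKZ system (de Gier–Pyatov 2010 / Di Francesco–Zinn-Justin 2007 /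
Hagendorf–Liénardy 2021), whose existence is IP12's external input in §3.5. The proof:

* `primitive_fixed_even` — the primitive ground state is EVEN in every rapidity (IP12: "the
  components … are only functions of `z_i²`"): the transfer matrix is even (`DiagonalStripQKZPinning`),
  so `P(-z_k) = ε P` with `ε = ±1`, and `ε = -1` would make `X_k` a common factor;
* `uSq`/`uHalf`/`genSq` — reading an even polynomial `Z(z)` as `Ẑ(U)`, `U = z²`, compatibly with
  renamings, inversions, the hyperplane `z_2 = q z_1` (`uSq_resEta`) and the wheel (`uSq_wheelSub`);
* `degreeOf_le_of_genInv_mul_pow`, `twist_nonpos` — field-form palindromicity bounds the degree and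
  the twist is nonpositive;
* `isWheelPoly_uHalf` — `Ẑ` is a wheel polynomial (`DiagonalStripWheelSpace`) of formal degree
  `D = -a'` with its own pair degree `B`, from the symmetry of `Z` (exact exchange relations), its
  `ι_k`-covariance (`DiagonalStripSumInversion`) and the wheel vanishing (`DiagonalStripSumRecursion`);
* `IsWheelPoly.class_of_pairDeg` — the degree analysis: nonvanishing on the hyperplane
  (`DiagonalStripScalarPinning.hypSubst_sum_ne_zero`) and `B ≤ 4m - 1` force `D = 2m` (the deficient
  case `D = 2m - 1` is empty), so `Ẑ` lies in the one-dimensional class of `χ̂_L`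
  (`IsWheelPoly.proportional_odd`, `uChar_isWheelPoly_odd`).

## References

* Y. Ikhlef, A. K. Ponsaing, *Finite-size left-passage probability in percolation*, J. Stat. Phys.
  149 (2012) 10–36, arXiv:1202.5476, §3.4–3.6, Prop. 3.4. [IkhlefPonsaing2012]
-/

namespace Literature.Probability.Percolation

open Finset Literature.Probability.LatticeModels Literature.Probability.LatticeModels.TemperleyLieb

/-! ### Evenness of the primitive ground state in every rapidity -/

section Evenness

open MvPolynomial

variable {m : ℕ}

/-- An odd polynomial in `X_k` is divisible by `X_k`. [folklore] -/
theorem X_dvd_of_substHom_neg_eq_neg {k : ℕ} {f : MvPolynomial ℕ ℂ} (h : substHom k (-X k) f = -f) : X k ∣ f := by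
  have h0 : substHom k (0 : MvPolynomial ℕ ℂ) f = 0 := by
    have hcomp : (substHom k (0 : MvPolynomial ℕ ℂ)).comp (substHom k (-X k)) = substHom k 0 := by
      refine algHom_ext fun n => ?_
      by_cases hn : n = k
      · subst hn; simp
      · simp [substHom_X_of_ne _ hn]
    have := AlgHom.congr_fun hcomp f
    rw [AlgHom.comp_apply, h, map_neg] at this
    have h2 : (2 : MvPolynomial ℕ ℂ) * substHom k 0 f = 0 := by linear_combination -this
    exact (mul_eq_zero.1 h2).resolve_left two_ne_zero
  simpa using X_sub_dvd_of_substHom_eq_zero h0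

/-- **The primitive ground state is even in every rapidity**: `P_Q(…, -z_k, …) = P_Q` (the transfer
matrix is even in each `z_k`, the flipped vector is again fixed hence a constant multiple `ε P` with
`ε = ±1`, and `ε = -1` would make `X_k` a common factor). [cite: IkhlefPonsaing2012, Prop. 4.5 (proof: "only functions of `z_i²`")] -/
theorem primitive_fixed_even {q : ℂ} (hq : q ^ 2 + q + 1 = 0) {P : ColPattern m → MvPolynomial ℕ ℂ}
    (hprim : PolyPrimitive P)
    (hP : ∀ Q', ∑ Q, ipTransferMatrixW m (genC ℂ q) (genW ℂ) (genZ ℂ) Q Q' * toRF ℂ (P Q) = toRF ℂ (P Q')) (k : ℕ)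
    (Q : ColPattern m) : substHom k (-X k) (P Q) = P Q := by
  obtain ⟨ε, hε, hεP⟩ := primitive_fixed_parity hq hprim hP k
  have hε1 : ε = 1 ∨ ε = -1 := by
    have : (ε - 1) * (ε + 1) = 0 := by linear_combination hε
    rcases mul_eq_zero.1 this with h | h
    · exact Or.inl (by linear_combination h)
    · exact Or.inr (by linear_combination h)
  rcases hε1 with rfl | rfl
  · rw [hεP Q, C_1, one_mul]
  · exfalso
    refine hprim.not_forall_dvd (d := X k) (MvPolynomial.X_prime (R := ℂ) (σ := ℕ) (i := k)).not_unit fun Q' => ?_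
    exact X_dvd_of_substHom_neg_eq_neg (by rw [hεP Q', map_neg, C_1, neg_one_mul])

/-- The flip on a monomial: a sign `(-1)^{s_k}`. [folklore] -/
theorem substHom_neg_monomial (k : ℕ) (s : ℕ →₀ ℕ) (c : ℂ) :
    substHom k (-X k) (monomial s c) = C ((-1) ^ s k) * monomial s c := by
  classical
  rw [substHom, aeval_monomial, MvPolynomial.algebraMap_eq]
  have hprod : (s.prod fun n e => (Function.update (fun n => (X n : MvPolynomial ℕ ℂ)) k (-X k) n) ^ e) =
      C ((-1) ^ s k) * s.prod fun n e => (X n : MvPolynomial ℕ ℂ) ^ e := by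
    have h1 : (s.prod fun n e => (Function.update (fun n => (X n : MvPolynomial ℕ ℂ)) k (-X k) n) ^ e) =
        s.prod fun n e => C ((-1 : ℂ) ^ (if n = k then e else 0)) * (X n : MvPolynomial ℕ ℂ) ^ e := by
      refine Finsupp.prod_congr fun n _ => ?_
      by_cases hn : n = k
      · subst hn; rw [Function.update_self, if_pos rfl, neg_pow, map_pow, map_neg, map_one]
      · rw [Function.update_of_ne hn, if_neg hn, pow_zero, C_1, one_mul]
    rw [h1, Finsupp.prod_mul]
    congr 1
    rw [Finsupp.prod, ← map_prod]
    congr 1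
    rw [Finset.prod_pow_eq_pow_sum, Finset.sum_ite_eq']
    split_ifs with h
    · rfl
    · rw [Finsupp.notMem_support_iff.1 h, pow_zero]
  rw [hprod, ← mul_assoc, mul_comm (C c), mul_assoc]
  congr 1
  rw [monomial_eq]

/-- The coefficients of the flipped polynomial. [folklore] -/
theorem coeff_substHom_neg (k : ℕ) (s : ℕ →₀ ℕ) (f : MvPolynomial ℕ ℂ) :
    coeff s (substHom k (-X k) f) = (-1) ^ s k * coeff s f := by
  classical
  conv_lhs => rw [f.as_sum, map_sum, coeff_sum]
  simp_rw [substHom_neg_monomial, coeff_C_mul, coeff_monomial]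
  rw [Finset.sum_eq_single s]
  · rw [if_pos rfl]
  · intro t _ hts; rw [if_neg hts, mul_zero]
  · intro hs; rw [notMem_support_iff.1 hs, if_pos rfl, mul_zero]

/-- **Hence all exponents are even**: every monomial of `P_Q` has an even exponent in `X_k`. [folklore] -/
theorem primitive_fixed_even_exponent {q : ℂ} (hq : q ^ 2 + q + 1 = 0) {P : ColPattern m → MvPolynomial ℕ ℂ}
    (hprim : PolyPrimitive P)
    (hP : ∀ Q', ∑ Q, ipTransferMatrixW m (genC ℂ q) (genW ℂ) (genZ ℂ) Q Q' * toRF ℂ (P Q) = toRF ℂ (P Q')) (k : ℕ)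
    (Q : ColPattern m) {s : ℕ →₀ ℕ} (hs : s ∈ (P Q).support) : Even (s k) := by
  by_contra hodd
  rw [Nat.not_even_iff_odd] at hodd
  have h := congrArg (coeff s) (primitive_fixed_even hq hprim hP k Q)
  rw [coeff_substHom_neg, hodd.neg_one_pow, neg_one_mul, neg_eq_iff_add_eq_zero, ← two_mul, mul_eq_zero] at h
  rcases h with h | h
  · exact two_ne_zero h
  · exact (mem_support_iff.1 hs) h

end Evenness

/-! ### The square map `U = z²` and its half-inverse on even polynomials -/

section Square

open MvPolynomial

variable {K₀ : Type*} [Field K₀]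

variable (K₀) in
/-- **`uSq : X_n ↦ X_n²`** (reading a polynomial in `U_n = z_n²` as a polynomial in the `z_n`). [folklore] -/
noncomputable def uSq : MvPolynomial ℕ K₀ →ₐ[K₀] MvPolynomial ℕ K₀ := aeval fun n => X n ^ 2

/-- `uSq` on variables. [folklore] -/
@[simp] theorem uSq_X (n : ℕ) : uSq K₀ (X n) = X n ^ 2 := by rw [uSq, aeval_X]

/-- `uSq` on constants. [folklore] -/
@[simp] theorem uSq_C (a : K₀) : uSq K₀ (C a) = C a := AlgHom.commutes _ a

/-- `uSq` on monomials: exponents are doubled. [folklore] -/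
theorem uSq_monomial (s : ℕ →₀ ℕ) (c : K₀) : uSq K₀ (monomial s c) = monomial (2 • s) c := by
  classical
  rw [uSq, aeval_monomial, MvPolynomial.algebraMap_eq, monomial_eq]
  congr 1
  rw [Finsupp.prod, Finsupp.prod_of_support_subset (2 • s) (s := s.support)
    (fun n hn => by
      rw [Finsupp.mem_support_iff] at hn ⊢
      simpa using hn) _ (fun n _ => pow_zero _)]
  refine Finset.prod_congr rfl fun n _ => ?_
  rw [← pow_mul, Finsupp.smul_apply, smul_eq_mul, mul_comm]

/-- The coefficients of `uSq F` at doubled exponents. [folklore] -/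
theorem coeff_uSq_two_smul (s : ℕ →₀ ℕ) (F : MvPolynomial ℕ K₀) : coeff (2 • s) (uSq K₀ F) = coeff s F := by
  classical
  conv_lhs => rw [F.as_sum, map_sum, coeff_sum]
  simp_rw [uSq_monomial, coeff_monomial]
  rw [Finset.sum_eq_single s]
  · rw [if_pos rfl]
  · intro t _ hts
    rw [if_neg]
    intro h
    apply hts
    ext n
    have := congrArg (fun f : ℕ →₀ ℕ => f n) h
    simp only [Finsupp.smul_apply, smul_eq_mul] at this
    omega
  · intro hs; rw [notMem_support_iff.1 hs, if_pos rfl]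

/-- The other coefficients of `uSq F` vanish. [folklore] -/
theorem coeff_uSq_eq_zero {t : ℕ →₀ ℕ} (ht : ∃ n, ¬ Even (t n)) (F : MvPolynomial ℕ K₀) : coeff t (uSq K₀ F) = 0 := by
  classical
  conv_lhs => rw [F.as_sum, map_sum, coeff_sum]
  simp_rw [uSq_monomial, coeff_monomial]
  refine Finset.sum_eq_zero fun s _ => ?_
  rw [if_neg]
  rintro rfl
  obtain ⟨n, hn⟩ := ht
  exact hn ⟨s n, by simp [two_mul]⟩

/-- **`uSq` is injective.** [folklore] -/
theorem uSq_injective : Function.Injective (uSq K₀) := fun F G h => by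
  ext s
  have := congrArg (coeff (2 • s)) h
  rwa [coeff_uSq_two_smul, coeff_uSq_two_smul] at this

variable (K₀) in
/-- **The half map** `Σ c_s X^s ↦ Σ c_s X^{s/2}` (a one-sided inverse of `uSq` on even polynomials). [folklore] -/
noncomputable def uHalf (F : MvPolynomial ℕ K₀) : MvPolynomial ℕ K₀ :=
  ∑ s ∈ F.support, monomial (s.mapRange (· / 2) (by simp)) (coeff s F)

/-- **`uSq (uHalf F) = F` for an even polynomial.** [folklore] -/
theorem uSq_uHalf {F : MvPolynomial ℕ K₀} (hF : ∀ s ∈ F.support, ∀ n, Even (s n)) : uSq K₀ (uHalf K₀ F) = F := by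
  classical
  rw [uHalf, map_sum]
  conv_rhs => rw [F.as_sum]
  refine Finset.sum_congr rfl fun s hs => ?_
  rw [uSq_monomial]
  have h2 : 2 • s.mapRange (· / 2) (by simp) = s := by
    ext n
    obtain ⟨r, hr⟩ := hF s hs n
    simp only [Finsupp.smul_apply, Finsupp.mapRange_apply, smul_eq_mul]
    omega
  rw [h2]

/-- The support of `uHalf F` consists of halved exponents. [folklore] -/
theorem mem_support_uHalf {F : MvPolynomial ℕ K₀} (hF : ∀ s ∈ F.support, ∀ n, Even (s n)) {t : ℕ →₀ ℕ}
    (ht : t ∈ (uHalf K₀ F).support) : 2 • t ∈ F.support := by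
  rw [mem_support_iff] at ht ⊢
  rwa [← uSq_uHalf hF, coeff_uSq_two_smul]

/-- **Degrees are halved.** [folklore] -/
theorem degreeOf_uHalf_le {F : MvPolynomial ℕ K₀} (hF : ∀ s ∈ F.support, ∀ n, Even (s n)) (n d : ℕ)
    (hd : F.degreeOf n ≤ 2 * d) : (uHalf K₀ F).degreeOf n ≤ d := by
  classical
  rw [degreeOf_eq_sup]
  refine Finset.sup_le fun t ht => ?_
  have := monomial_le_degreeOf n (mem_support_uHalf hF ht)
  simp only [Finsupp.smul_apply, smul_eq_mul] at this
  omega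

/-- **`uSq` commutes with renamings.** [folklore] -/
theorem rename_uSq (σ : ℕ → ℕ) (F : MvPolynomial ℕ K₀) : rename σ (uSq K₀ F) = uSq K₀ (rename σ F) := by
  have : (rename σ).comp (uSq K₀) = (uSq K₀).comp (rename σ) := by
    refine algHom_ext fun n => ?_
    simp only [AlgHom.comp_apply, uSq_X, map_pow, rename_X]
  exact AlgHom.congr_fun this F

variable (K₀) in
/-- **`genSq`: the field endomorphism `z_n ↦ z_n²`** extending `uSq`. [folklore] -/
noncomputable def genSq : RapidityField K₀ →+* RapidityField K₀ :=
  IsFractionRing.lift (g := (toRF K₀).comp (uSq K₀).toRingHom) (toRF_injective.comp uSq_injective)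

/-- `genSq` on polynomials. [folklore] -/
theorem genSq_toRF (F : MvPolynomial ℕ K₀) : genSq K₀ (toRF K₀ F) = toRF K₀ (uSq K₀ F) :=
  IsFractionRing.lift_algebraMap _ F

/-- `genSq` on rapidities. [folklore] -/
theorem genSq_genZ (n : ℕ) : genSq K₀ (genZ K₀ n) = genZ K₀ n ^ 2 := by
  rw [show genZ K₀ n = toRF K₀ (X n) from rfl, genSq_toRF, uSq_X, map_pow]

/-- `genSq` on constants. [folklore] -/
theorem genSq_genC (a : K₀) : genSq K₀ (genC K₀ a) = genC K₀ a := by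
  rw [show genC K₀ a = toRF K₀ (C a) from rfl, genSq_toRF, show uSq K₀ (C a) = C a from AlgHom.commutes _ a]

/-- `genSq` is injective. [folklore] -/
theorem genSq_injective : Function.Injective (genSq K₀) := (genSq K₀).injective

/-- **`genSq` commutes with the inversions `ι_n`.** [folklore] -/
theorem genSq_genInv (n : ℕ) (x : RapidityField K₀) : genSq K₀ (genInv K₀ n x) = genInv K₀ n (genSq K₀ x) := by
  have : (genSq K₀).comp (genInv K₀ n) = (genInv K₀ n).comp (genSq K₀) := by
    refine rapidityField_ringHom_ext (fun a => ?_) (fun k => ?_)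
    · rw [RingHom.comp_apply, RingHom.comp_apply, genInv_genC, genSq_genC, genInv_genC]
    · rw [RingHom.comp_apply, RingHom.comp_apply, genInv_genZ, genSq_genZ, map_pow, genInv_genZ]
      by_cases hk : k = n
      · subst hk; simp only [Function.update_self, map_inv₀, genSq_genZ, inv_pow]
      · simp only [Function.update_of_ne hk, genSq_genZ]
  exact RingHom.congr_fun this x

end Square

/-! ### Field-form palindromicity controls the degree and the sign of the twist -/

section PalDegree

open MvPolynomial

variable {K₀ : Type*} [Field K₀]

/-- The `X_k`-degree of the reversed polynomial. [folklore] -/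
theorem degreeOf_revPoly_le (k N : ℕ) (G : MvPolynomial ℕ K₀) : (revPoly k N G).degreeOf k ≤ N := by
  classical
  rw [revPoly]
  refine (degreeOf_sum_le _ _ _).trans (Finset.sup_le fun s _ => ?_)
  by_cases h0 : coeff s G = 0
  · rw [h0, monomial_zero, degreeOf_zero]; exact Nat.zero_le _
  · rw [degreeOf_monomial_eq _ _ h0, revExp_apply_self]; omega

/-- A coefficient of `G · X_k^e` below `e` vanishes. [folklore] -/
theorem coeff_mul_X_pow_eq_zero {G : MvPolynomial ℕ K₀} {k e : ℕ} {t : ℕ →₀ ℕ} (ht : t k < e) :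
    coeff t (G * X k ^ e) = 0 := by
  classical
  rw [X_pow_eq_monomial, coeff_mul_monomial', if_neg]
  intro hle
  have := hle k
  rw [Finsupp.single_eq_same] at this
  omega

/-- **Field-form palindromicity bounds the degree**: if `ι_n (toRF G) · z_n^D = toRF G` then
`deg_{X_n} G ≤ D`. [folklore] -/
theorem degreeOf_le_of_genInv_mul_pow {G : MvPolynomial ℕ K₀} {n D : ℕ}
    (h : genInv K₀ n (toRF K₀ G) * genZ K₀ n ^ D = toRF K₀ G) : G.degreeOf n ≤ D := by
  classical
  by_contra hlt
  push Not at hlt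
  set d := G.degreeOf n with hd
  have hG0 : G ≠ 0 := fun h0 => by rw [h0, degreeOf_zero] at hd; omega
  have hz : genZ K₀ n ≠ 0 := genZ_ne_zero n
  -- `revPoly n d G = G · X_n^{d - D}`
  have hrev : revPoly n d G = G * X n ^ (d - D) := by
    apply toRF_injective
    rw [← invSubst_mul_pow_eq n d G le_rfl, ← genInv_toRF, map_mul, map_pow, show toRF K₀ (X n) = genZ K₀ n from rfl]
    have e1 : genInv K₀ n (toRF K₀ G) = toRF K₀ G * (genZ K₀ n ^ D)⁻¹ :=
      (eq_mul_inv_iff_mul_eq₀ (pow_ne_zero _ hz)).2 h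
    rw [e1, mul_assoc, ← zpow_natCast, ← zpow_natCast, ← zpow_neg, ← zpow_add₀ hz, ← zpow_natCast]
    congr 2
    rw [Nat.cast_sub hlt.le]; ring
  -- a top monomial of `G` reverses to an `X_n`-free one
  have hne : G.support.Nonempty := Finset.nonempty_of_ne_empty fun h => hG0 (support_eq_empty.1 h)
  obtain ⟨s₀, hs₀, hs₀d⟩ := Finset.exists_mem_eq_sup G.support hne (fun s : ℕ →₀ ℕ => s n)
  rw [← degreeOf_eq_sup] at hs₀d
  have h1 : coeff (revExp n d s₀) (revPoly n d G) ≠ 0 := by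
    rw [coeff_revPoly le_rfl (by rw [revExp_apply_self]; omega), revExp_revExp (by omega)]
    exact mem_support_iff.1 hs₀
  rw [hrev, coeff_mul_X_pow_eq_zero (by rw [revExp_apply_self]; omega)] at h1
  exact h1 rfl

/-- **The twist of a nonzero polynomial is nonpositive**: `ι_n (toRF G) = z_n^c · toRF G` with `G ≠ 0`
forces `c ≤ 0`. [folklore] -/
theorem twist_nonpos {G : MvPolynomial ℕ K₀} (hG : G ≠ 0) {n : ℕ} {c : ℤ}
    (h : genInv K₀ n (toRF K₀ G) = genZ K₀ n ^ c * toRF K₀ G) : c ≤ 0 := by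
  by_contra hc
  push Not at hc
  set d := G.degreeOf n with hd
  have hz : genZ K₀ n ≠ 0 := genZ_ne_zero n
  obtain ⟨e, he⟩ : ∃ e : ℕ, (e : ℤ) = c := ⟨c.toNat, Int.toNat_of_nonneg hc.le⟩
  have he0 : 0 < e := by omega
  have hrev : revPoly n d G = X n ^ (e + d) * G := by
    apply toRF_injective
    rw [← invSubst_mul_pow_eq n d G le_rfl, ← genInv_toRF, h, map_mul, map_pow, show toRF K₀ (X n) = genZ K₀ n from rfl,
      ← he, zpow_natCast, pow_add]
    ring
  have h1 := degreeOf_revPoly_le n d G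
  rw [hrev, degreeOf_mul_eq (pow_ne_zero _ (X_ne_zero _)) hG, degreeOf_X_self_pow] at h1
  omega

end PalDegree

/-! ### From the even polynomial `Z(z)` to the wheel polynomial `Ẑ(U)` -/

section HatZ

open MvPolynomial

/-- `uSq ∘ resEta_{q²} = η_q ∘ uSq`: restricting `U_2 = q² U_1` is restricting `z_2 = q z_1`. [folklore] -/
theorem uSq_resEta (q : ℂ) (F : MvPolynomial ℕ ℂ) : uSq ℂ (resEta ℂ (q ^ 2) 1 F) = hypSubst q 1 (uSq ℂ F) := by
  have : (uSq ℂ).comp (resEta ℂ (q ^ 2) 1) =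
      (MvPolynomial.aeval (R := ℂ) fun k => if k = 1 + 1 then C q * X 1 else (X k : MvPolynomial ℕ ℂ)).comp (uSq ℂ) := by
    refine algHom_ext fun k => ?_
    by_cases hk : k = 1 + 1
    · subst hk
      simp only [AlgHom.comp_apply, resEta_X, ↓reduceIte, map_mul, uSq_C, uSq_X, map_pow, aeval_X]
      rw [mul_pow, ← map_pow]
    · simp only [AlgHom.comp_apply, resEta_X, if_neg hk, uSq_X, map_pow, aeval_X]
  have h := AlgHom.congr_fun this F
  rw [AlgHom.comp_apply, AlgHom.comp_apply] at h
  rw [h]; rfl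

/-- `uSq ∘ wheelSub_{q²}(1,2,k) = (z_2 ↦ q z_1, z_k ↦ q² z_1) ∘ uSq`. [folklore] -/
theorem uSq_wheelSub (q : ℂ) {k : ℕ} (hk : 3 ≤ k) (F : MvPolynomial ℕ ℂ) :
    uSq ℂ (wheelSub ℂ (q ^ 2) 1 2 k F) =
      aeval (fun n : ℕ => if n = 2 then C q * X 1 else if n = k then C (q ^ 2) * X 1 else (X n : MvPolynomial ℕ ℂ))
        (uSq ℂ F) := by
  have : (uSq ℂ).comp (wheelSub ℂ (q ^ 2) 1 2 k) =
      (MvPolynomial.aeval (R := ℂ) fun n : ℕ => if n = 2 then C q * X 1 else if n = k then C (q ^ 2) * X 1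
        else (X n : MvPolynomial ℕ ℂ)).comp (uSq ℂ) := by
    refine algHom_ext fun n => ?_
    have hw := wheelSub_X (K₀ := ℂ) (q ^ 2) (show (1 : ℕ) ≠ 2 by omega) (show 2 ≠ k by omega) (show 1 ≠ k by omega) n
    by_cases h2 : n = 2
    · subst h2
      rw [if_pos rfl] at hw
      simp only [AlgHom.comp_apply, hw, map_mul, uSq_C, uSq_X, map_pow, aeval_X, ↓reduceIte]
      rw [mul_pow, ← map_pow]
    · rw [if_neg h2] at hw
      by_cases h3 : n = k
      · subst h3
        rw [if_pos rfl] at hw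
        simp only [AlgHom.comp_apply, hw, map_mul, uSq_C, uSq_X, map_pow, aeval_X, if_neg h2, ↓reduceIte]
        ring
      · rw [if_neg h3] at hw
        simp only [AlgHom.comp_apply, hw, uSq_X, map_pow, aeval_X, if_neg h2, if_neg h3]
  have h := AlgHom.congr_fun this F
  rw [AlgHom.comp_apply, AlgHom.comp_apply] at h
  exact h

/-- Pair degrees are monotone in the bound. [folklore] -/
theorem IsWheelPoly.mono_pair {K₀ : Type*} [Field K₀] {ω : K₀} {u L D B B' : ℕ} {G : MvPolynomial ℕ K₀}
    (h : IsWheelPoly ω u L D B G) (hBB' : B ≤ B') : IsWheelPoly ω u L D B' G :=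
  ⟨h.vars, h.symm, h.deg, h.pal, fun s hs a b ha haL hb hbL hab => (h.pair s hs a b ha haL hb hbL hab).trans hBB', h.wheel⟩

/-- **The degree analysis of IP12 Prop. 3.4** ("the degree of `Z_L` is set by the qKZ equation"):
a nonzero wheel polynomial in `2m+1` variables with nonzero restriction and pair degree `≤ 4m-1`
(and `B` its exact `(u,u+1)` pair degree) has formal degree exactly `2m` and lies in the class
`(2m+1, 2m, 4m-1)`. [cite: IkhlefPonsaing2012, Prop. 3.4 (proof)] -/
theorem IsWheelPoly.class_of_pairDeg {K₀ : Type*} [Field K₀] {ω : K₀} (hω : ω ^ 2 + ω + 1 = 0) (hω1 : ω ≠ 1)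
    {u m D B : ℕ} {G : MvPolynomial ℕ K₀} (h : IsWheelPoly ω u (2 * m + 3) D B G) (hG : G ≠ 0)
    (hres : resEta K₀ ω u G ≠ 0) (hB : B ≤ 4 * m + 3) (hBdeg : B ≤ G.degreeOf u + G.degreeOf (u + 1)) :
    D = 2 * m + 2 ∧ IsWheelPoly ω u (2 * m + 3) (2 * m + 2) (4 * m + 3) G := by
  have hB2D : B ≤ 2 * D := by
    have h1 := h.deg u le_rfl (by omega)
    have h2 := h.deg (u + 1) (by omega) (by omega)
    omega
  have hwidth := h.two_mul_le_of_res_ne_zero hω hres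
  have hDle : D ≤ 2 * m + 2 := by omega
  have hDge : 2 * m + 1 ≤ D := by omega
  rcases Nat.lt_or_ge D (2 * m + 2) with hlt | hge
  · exfalso
    have hD : D = 2 * m + 1 := by omega
    have hBeq : B = 4 * m + 2 := by omega
    subst hD; subst hBeq
    exact hG (IsWheelPoly.eq_zero_deficient_odd hω hω1 m u h)
  · have hD : D = 2 * m + 2 := by omega
    subst hD
    exact ⟨rfl, h.mono_pair hB⟩

/-- **An even, symmetric, `ι`-covariant, wheel-vanishing polynomial `Z(z)` gives a wheel polynomial
`Ẑ(U)`**, `Z = Ẑ(z²)`, with formal degree `D = -(twist)/2` and its own `(U_1,U_2)` pair degree.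
[cite: IkhlefPonsaing2012, Prop. 3.4 (proof)] -/
theorem isWheelPoly_uHalf {q : ℂ} {L : ℕ} {Z : MvPolynomial ℕ ℂ}
    (heven : ∀ s ∈ Z.support, ∀ k, Even (s k))
    (hvars : ∀ k, ¬(1 ≤ k ∧ k < 1 + L) → Z.degreeOf k = 0)
    (hsym : ∀ a b : ℕ, 1 ≤ a → a ≤ b → b ≤ L → rename (Equiv.swap a b) Z = Z)
    {D : ℕ} (hinv : ∀ k, 1 ≤ k → k ≤ L → genInv ℂ k (toRF ℂ Z) = genZ ℂ k ^ (-(2 * (D : ℤ))) * toRF ℂ Z)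
    (hwheel : ∀ k, 3 ≤ k → k ≤ L →
      aeval (fun n : ℕ => if n = 2 then C q * X 1 else if n = k then C (q ^ 2) * X 1 else (X n : MvPolynomial ℕ ℂ)) Z = 0) :
    IsWheelPoly (q ^ 2) 1 L D (pairDeg 1 2 (uHalf ℂ Z)) (uHalf ℂ Z) := by
  have hGZ : uSq ℂ (uHalf ℂ Z) = Z := uSq_uHalf heven
  have hpal : ∀ k, 1 ≤ k → k < 1 + L → genInv ℂ k (toRF ℂ (uHalf ℂ Z)) * genZ ℂ k ^ D = toRF ℂ (uHalf ℂ Z) := by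
    intro k hk hkL
    apply genSq_injective
    have hz : genZ ℂ k ≠ 0 := genZ_ne_zero k
    rw [map_mul, genSq_genInv, map_pow, genSq_genZ, genSq_toRF, hGZ, hinv k hk (by omega), ← pow_mul, mul_assoc,
      mul_comm (toRF ℂ Z), ← mul_assoc, ← zpow_natCast, ← zpow_add₀ hz]
    have : (-(2 * (D : ℤ)) + ((2 * D : ℕ) : ℤ)) = 0 := by push_cast; ring
    rw [this, zpow_zero, one_mul]
  refine IsWheelPoly.of_base (fun k hk => ?_) (fun a b ha haL hb hbL => ?_)
    (fun k hk hkL => degreeOf_le_of_genInv_mul_pow (hpal k hk hkL)) hpal (fun s hs => le_pairDeg hs) (fun k hk hkL => ?_)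
  · exact Nat.eq_zero_of_le_zero (degreeOf_uHalf_le heven k 0 (by rw [hvars k hk]))
  · apply uSq_injective
    rw [← rename_uSq, hGZ]
    rcases le_total a b with hab | hab
    · exact hsym a b ha hab (by omega)
    · rw [Equiv.swap_comm]; exact hsym b a hb hab (by omega)
  · apply uSq_injective
    rw [uSq_wheelSub q (by omega), hGZ, hwheel k (by omega) (by omega), map_zero]

end HatZ

/-! ### IP12 Proposition 3.4: `Z = κ · χ̂_L(z²)` -/

section SumRule

open MvPolynomial

variable {n : ℕ}

/-- `q³ = 1` and `ω = q²` is again a primitive cube root of unity. [folklore] -/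
theorem omega_sq_quad {q : ℂ} (hq : q ^ 2 + q + 1 = 0) : (q ^ 2) ^ 2 + q ^ 2 + 1 = 0 := by
  have h3 : q ^ 3 = 1 := by linear_combination (q - 1) * hq
  linear_combination q * h3 + hq

/-- **IP12 Proposition 3.4 (sum rule), from the pair-degree bound and `w`-freeness of `Z`**: for the
primitive ground state `P` of `t(w; z⃗)` at width `m = n+1` (`L = 2n+3`) with `ι_1 ψ = z_1^{2a'} ψ` and
symmetric sum, if the `(z_1, z_2)` pair degree of `Z = Σ_Q P_Q` is at most `8m - 2` and `Z` is free of
`w`, then `a' = -2m` and `Z = κ · χ̂_L(z_1², …, z_L²)` with `κ ≠ 0`, `χ̂_L = uChar` the polynomial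
numerator of IP12's symplectic character. [cite: IkhlefPonsaing2012, Prop. 3.4] -/
theorem sum_eq_C_mul_uSq_uChar {q : ℂ} (hq : q ^ 2 + q + 1 = 0) {P : ColPattern (n + 1) → MvPolynomial ℕ ℂ} {a' : ℤ}
    (hprim : PolyPrimitive P)
    (hP : ∀ Q', ∑ Q, ipTransferMatrixW (n + 1) (genC ℂ q) (genW ℂ) (genZ ℂ) Q Q' * toRF ℂ (P Q) = toRF ℂ (P Q'))
    (hbot : ∀ Q, genInv ℂ 1 (toRF ℂ (P Q)) = genZ ℂ 1 ^ (2 * a') * toRF ℂ (P Q))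
    (hsym : ∀ a b : ℕ, 1 ≤ a → a ≤ b → b ≤ 2 * (n + 1) + 1 → rename (Equiv.swap a b) (∑ Q, P Q) = ∑ Q, P Q)
    (hpair : ∀ s ∈ (∑ Q, P Q).support, s 1 + s 2 ≤ 8 * (n + 1) - 2)
    (hw : (∑ Q, P Q).degreeOf 0 = 0) :
    a' = -(2 * (n : ℤ) + 2) ∧ ∃ κ : ℂ, κ ≠ 0 ∧ ∑ Q, P Q = C κ * uSq ℂ (uChar ℂ 1 (2 * (n + 1) + 1)) := by
  classical
  have hω := omega_sq_quad hq
  have hω1 : q ^ 2 ≠ 1 := sq_ne_one_of_quad hq (by norm_num)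
  set Z := ∑ Q, P Q with hZ
  -- nonvanishing on the hyperplane
  have hres0 : hypSubst q 1 Z ≠ 0 := hypSubst_sum_ne_zero hq hprim hP
  have hZ0 : Z ≠ 0 := fun h => hres0 (by rw [h, map_zero])
  -- evenness
  have heven : ∀ s ∈ Z.support, ∀ k, Even (s k) := by
    intro s hs k
    obtain ⟨Q, -, hQ⟩ := Finset.mem_biUnion.1 (support_sum hs)
    exact primitive_fixed_even_exponent hq hprim hP k Q hQ
  -- variables
  have hvars : ∀ k, ¬(1 ≤ k ∧ k < 1 + (2 * n + 3)) → Z.degreeOf k = 0 := by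
    intro k hk
    rcases Nat.eq_zero_or_pos k with rfl | hk0
    · exact hw
    · have hkL : 2 * (n + 1) + 1 < k := by omega
      apply Nat.eq_zero_of_le_zero
      refine (degreeOf_sum_le _ _ _).trans (Finset.sup_le fun Q _ => ?_)
      rw [primitive_fixed_degreeOf_eq_zero hq hprim hP hkL Q]
  -- the twist
  have hinvZ : ∀ k, 1 ≤ k → k ≤ 2 * n + 3 → genInv ℂ k (toRF ℂ Z) = genZ ℂ k ^ (2 * a') * toRF ℂ Z :=
    fun k hk hkL => sum_genInv_covariant hbot hsym hk (by omega)
  have ha' : a' ≤ 0 := by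
    have := twist_nonpos hZ0 (hinvZ 1 le_rfl (by omega))
    omega
  obtain ⟨D, hD⟩ : ∃ D : ℕ, (D : ℤ) = -a' := ⟨(-a').toNat, Int.toNat_of_nonneg (by omega)⟩
  have hinv : ∀ k, 1 ≤ k → k ≤ 2 * n + 3 → genInv ℂ k (toRF ℂ Z) = genZ ℂ k ^ (-(2 * (D : ℤ))) * toRF ℂ Z := by
    intro k hk hkL; rw [hinvZ k hk hkL, hD]; ring_nf
  -- the wheel polynomial `Ẑ`
  have h := isWheelPoly_uHalf (q := q) (L := 2 * n + 3) heven hvars (fun a b ha hab hb => hsym a b ha hab (by omega)) hinv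
    (fun k hk hkL => groundState_sum_wheel hq hP hk (hsym 3 k (by omega) hk (by omega)))
  set G := uHalf ℂ Z with hG
  have hGZ : uSq ℂ G = Z := uSq_uHalf heven
  have hG0 : G ≠ 0 := fun h0 => hZ0 (by rw [← hGZ, h0, map_zero])
  have hres : resEta ℂ (q ^ 2) 1 G ≠ 0 := fun h0 => hres0 (by rw [← hGZ, ← uSq_resEta, h0, map_zero])
  have hB : pairDeg 1 2 G ≤ 4 * n + 3 := by
    refine pairDeg_le_iff.2 fun t ht => ?_
    have := hpair (2 • t) (mem_support_uHalf heven ht)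
    simp only [Finsupp.smul_apply, smul_eq_mul] at this
    omega
  obtain ⟨hDeq, h'⟩ := h.class_of_pairDeg hω hω1 (m := n) hG0 hres hB (pairDeg_le_degreeOf_add 1 2 G)
  refine ⟨by omega, ?_⟩
  have hχ := uChar_isWheelPoly_odd (K₀ := ℂ) hω hω1 1 (n + 1)
  rw [show 2 * (n + 1) + 1 = 2 * n + 3 by ring, show 2 * (n + 1) = 2 * n + 2 by ring,
    show 4 * (n + 1) - 1 = 4 * n + 3 by omega] at hχ
  have hprop := IsWheelPoly.proportional_odd hω hω1 (n + 1) 1 (G₁ := G) (G₂ := uChar ℂ 1 (2 * n + 3))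
  rw [show 2 * (n + 1) + 1 = 2 * n + 3 by ring, show 2 * (n + 1) = 2 * n + 2 by ring,
    show 4 * (n + 1) - 1 = 4 * n + 3 by omega] at hprop
  obtain ⟨κ, hκ⟩ := hprop h' hχ (uChar_ne_zero 1 _)
  have hκ0 : κ ≠ 0 := fun h0 => hG0 (by rw [hκ, h0, C_0, zero_mul])
  refine ⟨κ, hκ0, ?_⟩
  rw [← hGZ, hκ, map_mul, uSq_C, show 2 * (n + 1) + 1 = 2 * n + 3 by ring]

end SumRule

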